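import Literature.AlgebraicGeometry.Motives.KunnethH1FibreRing
import Literature.AlgebraicGeometry.Morphisms.CechH1RestrictBase
import Mathlib.AlgebraicGeometry.Morphisms.Affine
import HarnessLib

/-!
# Künneth injectivity on the fibre of `X ×_A Y`, read over the base ring `A` on the preimage of a cover of `X ×_A Y`
# (the junction of ★ `KunnethH1FibreRing` with the unit-cocycle Step (I) ★ `CechUnitCocycleTwoFaceLift`)

Layer `Literature/AlgebraicGeometry/Motives`, namespace `Literature.AlgebraicGeometry.Motives`.  THEOREMS ONLY (no definition,
no named fact, no instance, no notation).  Cell `hodgecm-mathlib` (D-0151), F-2d road (R-def) «theorem of the cube over a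
NON-reduced base by Artinian induction», brick Č4e (author B-p07 (g16)).

★ Č4a `kunneth_cechH1_pullback_slices_injective` ([GortzWedhorn2023] Lemma 24.72 Step (I) with the proof of Thm. 24.73 and
Cor. 22.110) says: on the fibre `(X ×_A Y)_κ = σ^*(X ⊗ Y)` of two `A`-schemes with sections along a field-valued point
`σ : Spec κ → Spec A` (proper, geometrically integral fibres), a class of `Ȟ¹(𝒰, 𝒪)` (Čech cohomology OVER `κ`) that dies on the
base-changed slices `σ^*({x} × Y)`, `σ^*(X × {y})` is zero.  The one-step lift ★ Č4c `exists_rel_of_rel_map_of_rel_faces` consumes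
this as its hypothesis `hK`, but phrased (i) for Čech cohomology OVER `A` (the fibre as an `A`-scheme `Z → Spec κ → Spec A`, ★
`restrictBase`) and (ii) on the PREIMAGE `g⁻¹𝒰` of an affine cover `𝒰` of `X ×_A Y` under the projection
`g = pullback.fst : (X ×_A Y)_κ → X ×_A Y`.  This file makes the junction: (ii) the preimages are affine (`g` is affine, a base change
of `Spec κ → Spec A`) and cover; (i) vanishing of a class and of its pull-backs is insensitive to `restrictBase` (★ Č4a′
`CechH1.mk_eq_zero_iff_restrictBase`, `cechComapH1_mk_eq_zero_iff_restrictBase'`).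

* `isAffineOpen_preimageFamily_fst`, `iSup_preimageFamily_eq_top` — the preimage cover; `pullback_map_left_comp_restrictBase`;
* **`eq_zero_of_cechComapH1_pullback_slices_eq_zero`** — `hK` of Č4c for `X ⊗ Y`, faces the two slices, fibre along
  `σ = Spec (A → κ)`.

HC_CM is proved only modulo the 7 printed citations until rung 0 closes; nothing here is about HC.

## References
* [GortzWedhorn2023] U. Görtz, T. Wedhorn, *Algebraic Geometry II* (2023), Lemma 24.72 proof Step (I) (p. 409), Thm. 24.73
  proof (p. 410) with Cor. 22.110 (p. 287).
* [StacksProject] The Stacks Project, Tag 01ED (Čech cohomology, functoriality).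
-/

noncomputable section

universe u

open CategoryTheory CategoryTheory.Limits AlgebraicGeometry MonoidalCategory CartesianMonoidalCategory
open Literature.AlgebraicGeometry.Morphisms

namespace Literature.AlgebraicGeometry.Motives

variable {A : Type u} [CommRing A] {κ : Type u} [Field κ] [Algebra A κ]

/-- The preimages of affine opens of `W` under the projection `pullback.fst : W ×_A Spec κ → W` are affine (the projection is an
affine morphism, a base change of `Spec κ → Spec A`). [cite: StacksProject, Tag 01ED (Cohomology, Section 20.9)] -/
theorem isAffineOpen_preimageFamily_fst (W : SchemeOver A) {ι : Type u} (U : ι → W.left.Opens) (hU : ∀ i, IsAffineOpen (U i))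
    (i : ι) :
    IsAffineOpen (preimageFamily (pullback.fst W.hom (Spec.map (CommRingCat.ofHom (algebraMap A κ)))) U i) := by
  have : IsAffineHom (pullback.fst W.hom (Spec.map (CommRingCat.ofHom (algebraMap A κ)))) :=
    MorphismProperty.pullback_fst _ _ inferInstance
  exact (hU i).preimage _

/-- The preimages of a cover of `W` cover `W ×_A Spec κ`. [cite: StacksProject, Tag 01ED (Cohomology, Section 20.9)] -/
theorem iSup_preimageFamily_eq_top {W Z : Scheme.{u}} (g : Z ⟶ W) {ι : Type u} (U : ι → W.Opens) (hcov : ⨆ i, U i = ⊤) :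
    ⨆ i, preimageFamily g U i = ⊤ := by
  change ⨆ i, g ⁻¹ᵁ U i = ⊤
  rw [← Scheme.Hom.preimage_iSup, hcov, Scheme.Hom.preimage_top]

/-- A morphism `σ^*φ` of base changes is a morphism of `A`-schemes for the `restrictBase` structures (`σ^*W → Spec κ → Spec A`);
the structure maps are passed as variables `f = (σ^*W).hom` to keep the `A`-structure syntactic. [cite: StacksProject, Tag 01ED (Cohomology, Section 20.9)] -/
theorem pullback_map_left_comp_restrictBase (σ : Spec (.of κ) ⟶ Spec (.of A)) {W W' : SchemeOver A} (φ : W' ⟶ W)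
    {f : ((Over.pullback σ).obj W).left ⟶ Spec (.of κ)} (hf : f = ((Over.pullback σ).obj W).hom)
    {f' : ((Over.pullback σ).obj W').left ⟶ Spec (.of κ)} (hf' : f' = ((Over.pullback σ).obj W').hom) :
    ((Over.pullback σ).map φ).left ≫ restrictBase A f = restrictBase A f' := by
  have h : ((Over.pullback σ).map φ).left ≫ f = f' := by subst hf hf'; exact Over.w _
  subst h
  rw [restrictBase, restrictBase, Category.assoc]

/-- **KÜNNETH INJECTIVITY ON THE FIBRE, OVER THE BASE RING, ON A PREIMAGE COVER** — the hypothesis `hK` of ★ Č4c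
`exists_rel_of_rel_map_of_rel_faces` / ★ Č4c′ `forall_exists_rel_of_tower` for the family `X ⊗ Y → Spec A` with faces the slices
`{x} × Y`, `X × {y}` and fibre along `σ = Spec (A → κ)`: for `X`, `Y` over `Spec A` whose `κ`-fibres are proper and geometrically
integral, an affine cover `𝒰` of `X ×_A Y`, and a class `c ∈ Ȟ¹(g⁻¹𝒰, 𝒪)` of the fibre `Z = (X ×_A Y) ×_A Spec κ` regarded as an
`A`-scheme (`f_Z`, `f_{Z_X}`, `f_{Z_Y}` the structure maps of `σ^*(X ⊗ Y)`, `σ^*X`, `σ^*Y`, passed as variables): if `c` dies on the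
fibres of the two slices (pull-backs along `σ^*({x} × Y) → Z`, `σ^*(X × {y}) → Z`, over `A`), then `c = 0`.  Proof: transfer to
Čech cohomology over `κ` (★ Č4a′) and apply ★ Č4a.
[cite: GortzWedhorn2023, Lemma 24.72 proof Step (I) (p. 409)] [cite: GortzWedhorn2023, Thm. 24.73 proof p. 410 with Cor. 22.110 p. 287] -/
theorem eq_zero_of_cechComapH1_pullback_slices_eq_zero (X Y : SchemeOver A)
    [IsProper ((Over.pullback (Spec.map (CommRingCat.ofHom (algebraMap A κ)))).obj X).hom]
    [IsProper ((Over.pullback (Spec.map (CommRingCat.ofHom (algebraMap A κ)))).obj Y).hom]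
    [GeometricallyIntegral ((Over.pullback (Spec.map (CommRingCat.ofHom (algebraMap A κ)))).obj X).hom]
    [GeometricallyIntegral ((Over.pullback (Spec.map (CommRingCat.ofHom (algebraMap A κ)))).obj Y).hom]
    (x : 𝟙_ (SchemeOver A) ⟶ X) (y : 𝟙_ (SchemeOver A) ⟶ Y) {ι : Type u}
    (U : ι → (X ⊗ Y).left.Opens) (hU : ∀ i, IsAffineOpen (U i)) (hcov : ⨆ i, U i = ⊤)
    {fZ : ((Over.pullback (Spec.map (CommRingCat.ofHom (algebraMap A κ)))).obj (X ⊗ Y)).left ⟶ Spec (.of κ)}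
    (hfZ : fZ = ((Over.pullback (Spec.map (CommRingCat.ofHom (algebraMap A κ)))).obj (X ⊗ Y)).hom)
    {fZX : ((Over.pullback (Spec.map (CommRingCat.ofHom (algebraMap A κ)))).obj X).left ⟶ Spec (.of κ)}
    (hfZX : fZX = ((Over.pullback (Spec.map (CommRingCat.ofHom (algebraMap A κ)))).obj X).hom)
    {fZY : ((Over.pullback (Spec.map (CommRingCat.ofHom (algebraMap A κ)))).obj Y).left ⟶ Spec (.of κ)}
    (hfZY : fZY = ((Over.pullback (Spec.map (CommRingCat.ofHom (algebraMap A κ)))).obj Y).hom)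
    (c : CechH1 (restrictBase A fZ)
      (preimageFamily (pullback.fst (X ⊗ Y).hom (Spec.map (CommRingCat.ofHom (algebraMap A κ)))) U))
    (hx : cechComapH1 (restrictBase A fZ) (restrictBase A fZY)
        ((Over.pullback (Spec.map (CommRingCat.ofHom (algebraMap A κ)))).map ((λ_ Y).inv ≫ x ▷ Y)).left
        (pullback_map_left_comp_restrictBase _ _ hfZ hfZY) _ c = 0)
    (hy : cechComapH1 (restrictBase A fZ) (restrictBase A fZX)
        ((Over.pullback (Spec.map (CommRingCat.ofHom (algebraMap A κ)))).map ((ρ_ X).inv ≫ X ◁ y)).left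
        (pullback_map_left_comp_restrictBase _ _ hfZ hfZX) _ c = 0) :
    c = 0 := by
  subst hfZ hfZX hfZY
  obtain ⟨⟨η, hA⟩, rfl⟩ := CechH1.mk_surjective _ _ c
  have hB := (mem_cechZ1_iff_restrictBase (A := A)
    ((Over.pullback (Spec.map (CommRingCat.ofHom (algebraMap A κ)))).obj (X ⊗ Y)).hom _ η).2 hA
  have hU'aff := isAffineOpen_preimageFamily_fst (κ := κ) (X ⊗ Y) U hU
  have hcov' := iSup_preimageFamily_eq_top
    (pullback.fst (X ⊗ Y).hom (Spec.map (CommRingCat.ofHom (algebraMap A κ)))) U hcov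
  have hx' := (cechComapH1_mk_eq_zero_iff_restrictBase' (A := A) _
    ((Over.pullback (Spec.map (CommRingCat.ofHom (algebraMap A κ)))).obj Y).hom
    ((Over.pullback (Spec.map (CommRingCat.ofHom (algebraMap A κ)))).map ((λ_ Y).inv ≫ x ▷ Y)).left (Over.w _) η hA hB).2 hx
  have hy' := (cechComapH1_mk_eq_zero_iff_restrictBase' (A := A) _
    ((Over.pullback (Spec.map (CommRingCat.ofHom (algebraMap A κ)))).obj X).hom
    ((Over.pullback (Spec.map (CommRingCat.ofHom (algebraMap A κ)))).map ((ρ_ X).inv ≫ X ◁ y)).left (Over.w _) η hA hB).2 hy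
  have h0 := kunneth_cechH1_pullback_slices_injective (Spec.map (CommRingCat.ofHom (algebraMap A κ))) X Y x y _ hU'aff
    hcov' _ hx' hy'
  exact (CechH1.mk_eq_zero_iff_restrictBase (A := A) _ _ η hA hB).1 h0

end Literature.AlgebraicGeometry.Motives

end
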